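import Literature.MathematicalPhysics.QuantumLattice.HubbardTTPrimeGrandCanonicalThermalStatesExistence
import Literature.MathematicalPhysics.QuantumLattice.TorusSectorGibbsMixtureSpinFlip
import Literature.MathematicalPhysics.QuantumLattice.TorusSectorGibbsParticleHole
import Literature.MathematicalPhysics.QuantumLattice.HubbardGrandCanonicalParticleHole
import Literature.MathematicalPhysics.QuantumLattice.HubbardUniformDensityGibbs
import HarnessLib

/-!
# Symmetries of the grand-canonical Gibbs states of the `t–t'` Hubbard torus with chemical potential and Zeeman field:
# point group, spin exchange `h ↦ −h`, particle–hole `(t', μ, h) ↦ (−t', U − μ, −h)` (finite volume)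

Topic `Literature/MathematicalPhysics/QuantumLattice`; finite-volume half of the grand-canonical twin of the canonical-sector
symmetry files `TorusSectorGibbsMixtureSymmetry.lean` (`D₄`), `TorusSectorGibbsMixtureSpinFlip.lean` (spin exchange),
`TorusSectorGibbsParticleHole.lean` (particle–hole), for the grand-canonical Gibbs state `ρ_L = e^{−βK_L}/Ξ_L`
(`gcGibbsDensityTT'`, `K_L = gcTorusHamiltonianTT' L t t' U μ h = H_L − μN − hM`, eigen-mixture data
`gcGibbsWeightTT'`/`gcGibbsVectorTT'` of `HubbardTTPrimeGrandCanonicalGibbsMixture.lean`). Because the grand-canonical state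
lives on the WHOLE Fock space, everything reduces to one identity: for a unitary `W` with `W K_L(x) Wᴴ = K_L(x') + c·1`,
`tr(ρ_L(x) · Wᴴ Y W) = tr(ρ_L(x') · Y)` for every torus operator `Y` (§1,
`trace_gcGibbsDensityTT'_mul_conj_eq_of_conj_eq`; `…_of_commute` when `x' = x`). Instances:

* the point group `D₄` (`relabel_d4Perm_gcTorusHamiltonianTT'`, `fockD4_commute_gcTorusHamiltonianTT'`,
  `trace_gcGibbsDensityTT'_mul_relabel_d4Perm`: `tr(ρ_L · Γ_γ Y) = tr(ρ_L · Y)`);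
* the spin exchange (`relabel_spinSwap_spinImbalance : Γ_swap M = −M`, `relabel_spinSwap_gcTorusHamiltonianTT' :
  Γ_swap K_L(h) = K_L(−h)`, `trace_gcGibbsDensityTT'_mul_relabel_spinSwap : tr(ρ_L(h) · Γ_swap Y) = tr(ρ_L(−h) · Y)`);
* the particle–hole unitary `P_L` of the even torus (`particleHole_mul_spinImbalance_mul_conjTranspose : P M Pᴴ = −M`,
  `particleHole_gcTorusHamiltonianTT' : P K_L(t,t',U,μ,h) Pᴴ = K_L(t,−t',U,U−μ,−h) + (U−2μ)L²`,
  `trace_gcGibbsDensityTT'_mul_particleHoleAut : tr(ρ_L(t,t',U,μ,h) · α_L Y) = tr(ρ_L(t,−t',U,U−μ,−h) · Y)`);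
* §2 the same for the weighted TRANSLATION AVERAGES of transformed local observables (the quantities whose limits define
  torus-limit states): `sum_gcGibbsWeightTT'_mul_torusAvgExpectAt_d4Emb / _relabel_spinSwap / _phAut`.

The torus-limit consequences (D₄-invariance, spin-flip covariance / invariance at `h = 0`, particle–hole covariance /
self-duality at `t' = 0, μ = U/2, h = 0`) are in `HubbardTTPrimeGrandCanonicalThermalStatesSymmetries.lean`.
Everything is PROVED; no definition, no named fact, no instance. (Instance note: unitarity facts of the generic
orbital-type files are transported to the torus' `DecidableEq` path with `convert … using 4`, as in
`TorusSectorGibbsParticleHole`.)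

## Mathlib / tree search

REUSED: `trace_gcGibbsDensityTT'_mul_fermionEmbed_toTorusEmb`, `trace_gcGibbsDensityTT'_mul_eq_gibbsState`, `gcGibbsDensityTT'`
(`…ThermalStatesEntropyRow`); `gibbsState_unitary_conj`, `gibbsState_unitary_conj_of_invariant` (`HubbardUniformDensityGibbs`);
`gibbsState_add_smul_one`, `fermionEmbed_toTorusEmb_phAut` (`TorusSectorGibbsParticleHole`); `fermionEmbed_toTorusEmb_d4Emb`
(`HubbardWindowCertificateD4`), `relabel_d4Perm_hubbardTorusTT'` (`HubbardNNNHoppingWindowCertificateD4`),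
`fockD4_val_mul_val_conjTranspose_mul`, `fockD4_val_conjTranspose`, `Orb.d4Perm_eq_mapEquiv`, `relabel_mapEquiv_numberOp`,
`relabel_mapEquiv_totalNumber`, `relabel_eq_fockRelabel_conj`; `fermionEmbed_relabel_spinSwap` (`InfVolFermionStateSpinFlip`),
`fockSpinFlip_mul_conjTranspose_mul`, `conjTranspose_fockSpinFlip`, `relabel_spinSwap_hamiltonian`, `relabel_spinSwap_totalNumber`,
`relabel_spinSwap_numberOp`; `particleHole_hubbardTorusTT'` (`HubbardNNNHoppingParticleHole`), `particleHole_mul_totalNumber_mul_conjTranspose`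
(`HubbardGrandCanonicalParticleHole`), `particleHole_mul_numberAt_mul_conjTranspose_holds`, `particleHole_mul_conjTranspose`,
`particleHole_conjTranspose_mul`, `norm_intCast_units`. `lean search 'relabel_d4Perm_gc|spinSwap_gc|particleHole_gcTorus'`: nothing
(2026-08-27) — the canonical sector has all three symmetry files, the grand-canonical state had none.

## References

* R. B. Israel, *Convexity in the Theory of Lattice Gases* (1979), §I.3 eq. (26) (periodic Gibbs states). [cite: Israel1979, §I.3 eq. (26)]
* O. Bratteli, D. W. Robinson, *OAQSM 2* (1997), §5.3.1 (symmetries of Gibbs/KMS states); §5.2.2 Thm. 5.2.5 (Bogoliubov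
  automorphisms of the CAR algebra). [cite: BratteliRobinsonII1997, §5.3.1]
* E. H. Lieb, M. Loss, R. J. McCann, J. Math. Phys. 34 (1993) 891, Theorem and its proof (particle–hole conjugation of Gibbs states).
  [cite: LiebLossMccann1993, Theorem]
* F. H. L. Essler et al., *The One-Dimensional Hubbard Model* (2005), §2.2.4 eqs. (2.59)–(2.61). [cite: EsslerEtAl2005, §2.2.4 eqs. (2.59)–(2.61)]
* X. Han, arXiv:2006.06002 (2020), §3 (symmetry constraints `⟨g·O⟩ = ⟨O⟩` in bootstrap relaxations). [cite: Han2020Bootstrap, §3]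
-/

noncomputable section

namespace Literature.MathematicalPhysics.QuantumLattice

open Matrix Finset HubbardWave0 Literature.Probability.LatticeModels ThermodynamicLimit
open _root_.Filter
open scoped _root_.Topology ComplexOrder BigOperators

/-! ### §1 Finite volume: the grand-canonical Gibbs state under a unitary conjugating `K_L(x)` to `K_L(x') + c` -/

section FiniteVolume

variable (L : ℕ) [NeZero L]

omit [NeZero L] in
/-- **Covariance of the grand-canonical Gibbs state.** If `W` is unitary and `W K_L(x) Wᴴ = K_L(x') + c·1` then
`tr(ρ_L(x) · (Wᴴ Y W)) = tr(ρ_L(x') · Y)` for every torus operator `Y` (`e^{−β(K'+c)}`-states do not see `c`;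
`tr(e^{−βK} WᴴYW) = tr(W e^{−βK} Wᴴ Y)`). [cite: BratteliRobinsonII1997, §5.3.1] -/
theorem trace_gcGibbsDensityTT'_mul_conj_eq_of_conj_eq (β t t' U μ hz t₁ t'₁ U₁ μ₁ h₁ : ℝ) (c : ℝ)
    {W : Matrix (Finset (Orb (FermionTorus 2 L))) (Finset (Orb (FermionTorus 2 L))) ℂ}
    (hWW : Wᴴ * W = 1) (hWW' : W * Wᴴ = 1)
    (hK : W * gcTorusHamiltonianTT' L t t' U μ hz * Wᴴ =
      gcTorusHamiltonianTT' L t₁ t'₁ U₁ μ₁ h₁ +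
        (c : ℂ) • (1 : Matrix (Finset (Orb (FermionTorus 2 L))) (Finset (Orb (FermionTorus 2 L))) ℂ))
    (Y : Matrix (Finset (Orb (FermionTorus 2 L))) (Finset (Orb (FermionTorus 2 L))) ℂ) :
    (gcGibbsDensityTT' L β t t' U μ hz * (Wᴴ * Y * W)).trace = (gcGibbsDensityTT' L β t₁ t'₁ U₁ μ₁ h₁ * Y).trace := by
  rw [trace_gcGibbsDensityTT'_mul_eq_gibbsState, trace_gcGibbsDensityTT'_mul_eq_gibbsState]
  -- `K(x) = Wᴴ (K(x') + c) W`
  have hK' : gcTorusHamiltonianTT' L t t' U μ hz =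
      Wᴴ * (gcTorusHamiltonianTT' L t₁ t'₁ U₁ μ₁ h₁ +
        (c : ℂ) • (1 : Matrix (Finset (Orb (FermionTorus 2 L))) (Finset (Orb (FermionTorus 2 L))) ℂ)) * W := by
    rw [← hK]
    calc gcTorusHamiltonianTT' L t t' U μ hz
        = (Wᴴ * W) * gcTorusHamiltonianTT' L t t' U μ hz * (Wᴴ * W) := by rw [hWW, Matrix.one_mul, Matrix.mul_one]
      _ = Wᴴ * (W * gcTorusHamiltonianTT' L t t' U μ hz * Wᴴ) * W := by simp only [Matrix.mul_assoc]
  conv_lhs => rw [hK']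
  rw [gibbsState_unitary_conj β hWW hWW', gibbsState_add_smul_one]

omit [NeZero L] in
/-- **Invariance of the grand-canonical Gibbs state** under a unitary commuting with `K_L`:
`tr(ρ_L · (W Y Wᴴ)) = tr(ρ_L · Y)`. [cite: BratteliRobinsonII1997, §5.3.1] -/
theorem trace_gcGibbsDensityTT'_mul_conj_eq_of_commute (β t t' U μ hz : ℝ)
    {W : Matrix (Finset (Orb (FermionTorus 2 L))) (Finset (Orb (FermionTorus 2 L))) ℂ}
    (hWW : Wᴴ * W = 1) (hWW' : W * Wᴴ = 1) (hc : Commute W (gcTorusHamiltonianTT' L t t' U μ hz))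
    (Y : Matrix (Finset (Orb (FermionTorus 2 L))) (Finset (Orb (FermionTorus 2 L))) ℂ) :
    (gcGibbsDensityTT' L β t t' U μ hz * (W * Y * Wᴴ)).trace = (gcGibbsDensityTT' L β t t' U μ hz * Y).trace := by
  rw [trace_gcGibbsDensityTT'_mul_eq_gibbsState, trace_gcGibbsDensityTT'_mul_eq_gibbsState]
  refine gibbsState_unitary_conj_of_invariant β hWW ?_ Y
  rw [hc.eq, Matrix.mul_assoc, hWW', Matrix.mul_one]

/-! #### The point group -/

/-- `U_γ M U_γᴴ = M`: the spin imbalance `M = Σₓ (nₓ↑ − nₓ↓)` is invariant under site permutations.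
[cite: BratteliRobinsonII1997, §5.2.2, Thm. 5.2.5] -/
theorem relabel_mapEquiv_spinImbalance {Λ : Type*} [LinearOrder Λ] [Fintype Λ] (g : Equiv.Perm Λ) :
    relabel (Orb.mapEquiv g) (spinImbalance : Matrix (Finset (Orb Λ)) (Finset (Orb Λ)) ℂ) = spinImbalance := by
  rw [spinImbalance, relabel_sum]
  simp_rw [relabel_sub, relabel_mapEquiv_numberOp]
  exact Equiv.sum_comp g (fun x => numberOp x 0 - numberOp x 1)

/-- **`D₄` invariance of `K_L`**: `U_γ K_L(t,t',U,μ,h) U_γᴴ = K_L(t,t',U,μ,h)` (`H_L`, `N`, `M` are all invariant).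
[cite: Han2020Bootstrap, §3] -/
theorem relabel_d4Perm_gcTorusHamiltonianTT' (γ : DihedralGroup 4) (t t' U μ hz : ℝ) :
    relabel (Orb.d4Perm (L := L) γ) (gcTorusHamiltonianTT' L t t' U μ hz) = gcTorusHamiltonianTT' L t t' U μ hz := by
  rw [gcTorusHamiltonianTT', relabel_sub, relabel_sub, relabel_smul, relabel_smul, relabel_d4Perm_hubbardTorusTT',
    Orb.d4Perm_eq_mapEquiv, relabel_mapEquiv_totalNumber, relabel_mapEquiv_spinImbalance]

/-- `[U_γ, K_L] = 0`. [cite: Han2020Bootstrap, §3] -/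
theorem fockD4_commute_gcTorusHamiltonianTT' (γ : DihedralGroup 4) (t t' U μ hz : ℝ) :
    Commute (fockD4 (L := L) γ).val (gcTorusHamiltonianTT' L t t' U μ hz) := by
  rw [fockD4_apply]
  exact fockRelabel_commute_of_relabel_eq _ (relabel_d4Perm_gcTorusHamiltonianTT' L γ t t' U μ hz)

/-- **Point-group invariance of the grand-canonical Gibbs state**: `tr(ρ_L · U_γ Y U_γᴴ) = tr(ρ_L · Y)` for every
`γ ∈ D₄` and every torus operator `Y`. [cite: Han2020Bootstrap, §3] -/
theorem trace_gcGibbsDensityTT'_mul_relabel_d4Perm (β t t' U μ hz : ℝ) (γ : DihedralGroup 4)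
    (Y : Matrix (Finset (Orb (FermionTorus 2 L))) (Finset (Orb (FermionTorus 2 L))) ℂ) :
    (gcGibbsDensityTT' L β t t' U μ hz * relabel (Orb.d4Perm (L := L) γ) Y).trace =
      (gcGibbsDensityTT' L β t t' U μ hz * Y).trace := by
  rw [relabel_eq_fockRelabel_conj, ← fockD4_apply]
  -- unitarity in instance-free form (`fockD4_val_mul_val_conjTranspose_mul`)
  have hWW' : (fockD4 (L := L) γ).val * (fockD4 (L := L) γ).valᴴ = 1 := by
    have h := fockD4_val_mul_val_conjTranspose_mul L γ 1
    rwa [Matrix.mul_one] at h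
  have hWW : (fockD4 (L := L) γ).valᴴ * (fockD4 (L := L) γ).val = 1 := by
    have h := fockD4_val_mul_val_conjTranspose_mul L γ⁻¹ 1
    rwa [Matrix.mul_one, fockD4_val_conjTranspose, inv_inv, ← fockD4_val_conjTranspose] at h
  exact trace_gcGibbsDensityTT'_mul_conj_eq_of_commute L β t t' U μ hz hWW hWW'
    (fockD4_commute_gcTorusHamiltonianTT' L γ t t' U μ hz) Y

/-! #### The spin exchange -/

/-- `Γ_swap M = −M`. [cite: BratteliRobinsonII1997, §5.2.2, Thm. 5.2.5] -/
theorem relabel_spinSwap_spinImbalance {Λ : Type*} [LinearOrder Λ] [Fintype Λ] :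
    relabel (Orb.spinSwap : Orb Λ ≃ Orb Λ) (spinImbalance : Matrix (Finset (Orb Λ)) (Finset (Orb Λ)) ℂ) =
      -spinImbalance := by
  rw [spinImbalance, relabel_sum, ← Finset.sum_neg_distrib]
  refine Finset.sum_congr rfl fun x _ => ?_
  rw [relabel_sub, relabel_spinSwap_numberOp, relabel_spinSwap_numberOp]
  simp only [Equiv.swap_apply_left, Equiv.swap_apply_right, neg_sub]

omit [NeZero L] in
/-- **The spin exchange flips the Zeeman field**: `Γ_swap K_L(t,t',U,μ,h) = K_L(t,t',U,μ,−h)`.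
[cite: BratteliRobinsonII1997, §5.2.2, Thm. 5.2.5] -/
theorem relabel_spinSwap_gcTorusHamiltonianTT' (t t' U μ hz : ℝ) :
    relabel (Orb.spinSwap : Orb (FermionTorus 2 L) ≃ Orb (FermionTorus 2 L)) (gcTorusHamiltonianTT' L t t' U μ hz) =
      gcTorusHamiltonianTT' L t t' U μ (-hz) := by
  have hH : relabel (Orb.spinSwap : Orb (FermionTorus 2 L) ≃ Orb (FermionTorus 2 L)) (hubbardTorusTT' L t t' U) =
      hubbardTorusTT' L t t' U := by
    rw [hubbardTorusTT', relabel_add, relabel_spinSwap_hamiltonian, relabel_spinSwap_hamiltonian]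
  rw [gcTorusHamiltonianTT', gcTorusHamiltonianTT', relabel_sub, relabel_sub, relabel_smul, relabel_smul, hH,
    relabel_spinSwap_totalNumber, relabel_spinSwap_spinImbalance, smul_neg, Complex.ofReal_neg, neg_smul, sub_neg_eq_add]

/-- **Spin-exchange covariance of the grand-canonical Gibbs state**: `tr(ρ_L(h) · Γ_swap Y) = tr(ρ_L(−h) · Y)` for
every torus operator `Y`. [cite: BratteliRobinsonII1997, §5.3.1] -/
theorem trace_gcGibbsDensityTT'_mul_relabel_spinSwap (β t t' U μ hz : ℝ)
    (Y : Matrix (Finset (Orb (FermionTorus 2 L))) (Finset (Orb (FermionTorus 2 L))) ℂ) :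
    (gcGibbsDensityTT' L β t t' U μ hz *
        relabel (Orb.spinSwap : Orb (FermionTorus 2 L) ≃ Orb (FermionTorus 2 L)) Y).trace =
      (gcGibbsDensityTT' L β t t' U μ (-hz) * Y).trace := by
  set F : Matrix (Finset (Orb (FermionTorus 2 L))) (Finset (Orb (FermionTorus 2 L))) ℂ := fockSpinFlip with hF
  -- unitarity in instance-free form (`fockSpinFlip_mul_conjTranspose_mul`), and `Fᴴ = F`
  have hFh : Fᴴ = F := by rw [hF]; exact conjTranspose_fockSpinFlip (L := L)
  have hFF' : F * Fᴴ = 1 := by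
    have h := fockSpinFlip_mul_conjTranspose_mul L 1
    rwa [Matrix.mul_one, ← hF] at h
  have hFF : Fᴴ * F = 1 := by
    have h := hFF'
    rw [hFh] at h ⊢
    exact h
  have hFY : relabel (Orb.spinSwap : Orb (FermionTorus 2 L) ≃ Orb (FermionTorus 2 L)) Y = Fᴴ * Y * F := by
    rw [relabel_eq_fockRelabel_conj, ← fockSpinFlip_def, ← hF, hFh]
  have hK : F * gcTorusHamiltonianTT' L t t' U μ hz * Fᴴ = gcTorusHamiltonianTT' L t t' U μ (-hz) +
      ((0 : ℝ) : ℂ) • (1 : Matrix (Finset (Orb (FermionTorus 2 L))) (Finset (Orb (FermionTorus 2 L))) ℂ) := by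
    rw [Complex.ofReal_zero, zero_smul, add_zero, ← relabel_spinSwap_gcTorusHamiltonianTT',
      relabel_eq_fockRelabel_conj, ← fockSpinFlip_def]
  rw [hFY]
  exact trace_gcGibbsDensityTT'_mul_conj_eq_of_conj_eq L β t t' U μ hz t t' U μ (-hz) 0 hFF hFF' hK Y

/-! #### The particle–hole transformation of the even torus -/

/-- `P M Pᴴ = −M` (`n_{xσ} ↦ 1 − n_{xσ}` for both spins). [cite: LiebLossMccann1993, proof of Theorem] -/
theorem particleHole_mul_spinImbalance_mul_conjTranspose {Λ : Type*} [LinearOrder Λ] [Fintype Λ]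
    (ε : Orb Λ → ℂ) (hε : ∀ i, ‖ε i‖ = 1) :
    particleHole ε * spinImbalance * (particleHole ε)ᴴ = -(spinImbalance : Matrix (Finset (Orb Λ)) (Finset (Orb Λ)) ℂ) := by
  have hnum : ∀ (x : Λ) (σ : Fin 2), particleHole ε * numberOp x σ * (particleHole ε)ᴴ = 1 - numberOp x σ :=
    fun x σ => particleHole_mul_numberAt_mul_conjTranspose_holds ε hε (orb x σ)
  rw [spinImbalance, Finset.mul_sum, Finset.sum_mul, ← Finset.sum_neg_distrib]
  refine Finset.sum_congr rfl fun x _ => ?_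
  rw [Matrix.mul_sub, Matrix.sub_mul, hnum, hnum]
  abel

omit [NeZero L] in
/-- **Particle–hole conjugation of `K_L`** (`L` even, staggered phases):
`P K_L(t,t',U,μ,h) Pᴴ = K_L(t,−t',U,U−μ,−h) + (U − 2μ)L²·1`. [cite: EsslerEtAl2005, §2.2.4 eqs. (2.59)–(2.61)] -/
theorem particleHole_gcTorusHamiltonianTT' (hL : Even L) (t t' U μ hz : ℝ) :
    particleHole (fun i : Orb (FermionTorus 2 L) => ((torusStagger (ofLex i).1 : ℤ) : ℂ)) *
        gcTorusHamiltonianTT' L t t' U μ hz *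
        (particleHole (fun i : Orb (FermionTorus 2 L) => ((torusStagger (ofLex i).1 : ℤ) : ℂ)))ᴴ =
      gcTorusHamiltonianTT' L t (-t') U (U - μ) (-hz) +
        (((U - 2 * μ) * L ^ 2 : ℝ) : ℂ) • (1 : Matrix (Finset (Orb (FermionTorus 2 L))) (Finset (Orb (FermionTorus 2 L))) ℂ) := by
  set P := particleHole (fun i : Orb (FermionTorus 2 L) => ((torusStagger (ofLex i).1 : ℤ) : ℂ)) with hP
  have hε : ∀ i : Orb (FermionTorus 2 L), ‖((torusStagger (ofLex i).1 : ℤ) : ℂ)‖ = 1 := fun i => norm_intCast_units _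
  have hH := particleHole_hubbardTorusTT' hL t t' U
  have hN := particleHole_mul_totalNumber_mul_conjTranspose (Λ := FermionTorus 2 L)
    (fun i : Orb (FermionTorus 2 L) => ((torusStagger (ofLex i).1 : ℤ) : ℂ)) hε
  have hM := particleHole_mul_spinImbalance_mul_conjTranspose (Λ := FermionTorus 2 L)
    (fun i : Orb (FermionTorus 2 L) => ((torusStagger (ofLex i).1 : ℤ) : ℂ)) hε
  have hcard : Fintype.card (FermionTorus 2 L) = L ^ 2 := by simp [FermionTorus, Fintype.card_lex]
  rw [hcard] at hN
  rw [← hP] at hH hN hM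
  rw [gcTorusHamiltonianTT', gcTorusHamiltonianTT', Matrix.mul_sub, Matrix.mul_sub, Matrix.sub_mul, Matrix.sub_mul,
    Matrix.mul_smul, Matrix.smul_mul, Matrix.mul_smul, Matrix.smul_mul, hH, hN, hM]
  -- bookkeeping of the scalar multiples of `1`
  ext i j
  simp only [Matrix.sub_apply, Matrix.add_apply, Matrix.smul_apply, Matrix.one_apply, Matrix.neg_apply, smul_eq_mul]
  push_cast
  split_ifs <;> ring

omit [NeZero L] in
/-- **Particle–hole covariance of the grand-canonical Gibbs state** (`L` even): for every torus operator `Y`,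
`tr(ρ_L(t,t',U,μ,h) · α_L Y) = tr(ρ_L(t,−t',U,U−μ,−h) · Y)`, `α_L Y = P Y Pᴴ`. [cite: LiebLossMccann1993, proof of Theorem] -/
theorem trace_gcGibbsDensityTT'_mul_particleHoleAut (hL : Even L) (β t t' U μ hz : ℝ)
    (Y : Matrix (Finset (Orb (FermionTorus 2 L))) (Finset (Orb (FermionTorus 2 L))) ℂ) :
    (gcGibbsDensityTT' L β t t' U μ hz *
        particleHoleAut (fun i : Orb (FermionTorus 2 L) => torusStagger (ofLex i).1) Y).trace =
      (gcGibbsDensityTT' L β t (-t') U (U - μ) (-hz) * Y).trace := by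
  set P := particleHole (fun i : Orb (FermionTorus 2 L) => ((torusStagger (ofLex i).1 : ℤ) : ℂ)) with hP
  have hε : ∀ i : Orb (FermionTorus 2 L), ‖((torusStagger (ofLex i).1 : ℤ) : ℂ)‖ = 1 := fun i => norm_intCast_units _
  -- unitarity, transported to this file's instance path (`DecidableEq` instances are subsingletons)
  have hPP : P * Pᴴ = 1 := by convert particleHole_mul_conjTranspose _ hε using 4
  have hPP' : Pᴴ * P = 1 := by convert particleHole_conjTranspose_mul _ hε using 4
  -- the conjugation identity at the image parameters reads `Pᴴ`-wise: `Pᴴ K(x) P = K(x') + c'`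
  have hK' := particleHole_gcTorusHamiltonianTT' L hL t (-t') U (U - μ) (-hz)
  rw [neg_neg, neg_neg, sub_sub_cancel, ← hP] at hK'
  -- `W = Pᴴ`
  have hK : Pᴴ * gcTorusHamiltonianTT' L t t' U μ hz * Pᴴᴴ = gcTorusHamiltonianTT' L t (-t') U (U - μ) (-hz) +
      ((-((U - 2 * (U - μ)) * L ^ 2) : ℝ) : ℂ) •
        (1 : Matrix (Finset (Orb (FermionTorus 2 L))) (Finset (Orb (FermionTorus 2 L))) ℂ) := by
    rw [conjTranspose_conjTranspose]
    have h1 : Pᴴ * (P * gcTorusHamiltonianTT' L t (-t') U (U - μ) (-hz) * Pᴴ) * P =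
        gcTorusHamiltonianTT' L t (-t') U (U - μ) (-hz) := by
      calc Pᴴ * (P * gcTorusHamiltonianTT' L t (-t') U (U - μ) (-hz) * Pᴴ) * P
          = (Pᴴ * P) * gcTorusHamiltonianTT' L t (-t') U (U - μ) (-hz) * (Pᴴ * P) := by simp only [Matrix.mul_assoc]
        _ = gcTorusHamiltonianTT' L t (-t') U (U - μ) (-hz) := by rw [hPP', Matrix.one_mul, Matrix.mul_one]
    rw [hK'] at h1
    rw [Matrix.mul_add, Matrix.add_mul, Matrix.mul_smul, Matrix.smul_mul, Matrix.mul_one, hPP'] at h1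
    rw [← h1, add_assoc, ← add_smul, Complex.ofReal_neg]
    simp only [add_neg_cancel, zero_smul, add_zero, Matrix.mul_assoc]
  rw [particleHoleAut_apply]
  have hY : particleHole (fun i : Orb (FermionTorus 2 L) => (((torusStagger (ofLex i).1 : ℤˣ) : ℤ) : ℂ)) * Y *
      (particleHole (fun i : Orb (FermionTorus 2 L) => (((torusStagger (ofLex i).1 : ℤˣ) : ℤ) : ℂ)))ᴴ = Pᴴᴴ * Y * Pᴴ := by
    rw [conjTranspose_conjTranspose]
  rw [hY]
  exact trace_gcGibbsDensityTT'_mul_conj_eq_of_conj_eq L β t t' U μ hz t (-t') U (U - μ) (-hz) _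
    (by rw [conjTranspose_conjTranspose]; exact hPP) (by rw [conjTranspose_conjTranspose]; exact hPP') hK Y

end FiniteVolume

/-! ### §2 Translation averages of the transformed local observables -/

section Averages

variable (L : ℕ) [NeZero L] (β t t' U μ hz : ℝ)

/-- **The weighted translation average of the `D₄`-image of a local observable equals that of the observable** in the
grand-canonical Gibbs mixture: for `γ ∈ D₄`, `Λ` and `γΛ` fitting into the torus and `A ∈ 𝔄_Λ`,
`Σ_i p_i avg_{γΛ}(Γ(d4Emb γ 0 Λ) A) ψ_i = Σ_i p_i avg_Λ(A) ψ_i`. [cite: Han2020Bootstrap, §3] -/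
theorem sum_gcGibbsWeightTT'_mul_torusAvgExpectAt_d4Emb (γ : DihedralGroup 4) {Λ : Finset (Site 2)}
    (hInj : Set.InjOn (Torus.proj (d := 2) L) ↑Λ) (hInj' : Set.InjOn (Torus.proj (d := 2) L) ↑(d4ShiftSet γ 0 Λ))
    (A : FermionOp Λ) :
    ∑ i, (gcGibbsWeightTT' β t t' U μ hz L i : ℂ) *
        torusAvgExpectAt L (d4ShiftSet γ 0 Λ) (fermionEmbed (PolySite.d4Emb γ 0 Λ) A) (gcGibbsVectorTT' t t' U μ hz L i) =
      ∑ i, (gcGibbsWeightTT' β t t' U μ hz L i : ℂ) * torusAvgExpectAt L Λ A (gcGibbsVectorTT' t t' U μ hz L i) := by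
  have hproj : Torus.proj L (0 : Site 2) = 0 := by funext i; simp [Torus.proj]
  rw [← trace_gcGibbsDensityTT'_mul_fermionEmbed_toTorusEmb L β t t' U μ hz hInj',
    ← trace_gcGibbsDensityTT'_mul_fermionEmbed_toTorusEmb L β t t' U μ hz hInj,
    fermionEmbed_toTorusEmb_d4Emb γ 0 hInj hInj' A, hproj, Orb.translate_zero, Equiv.Perm.one_def, relabel_refl]
  exact trace_gcGibbsDensityTT'_mul_relabel_d4Perm L β t t' U μ hz γ _

/-- **The weighted translation average of `Γ_swap A` in the Gibbs mixture at field `h` equals that of `A` at `−h`.**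
[cite: BratteliRobinsonII1997, §5.3.1] -/
theorem sum_gcGibbsWeightTT'_mul_torusAvgExpectAt_relabel_spinSwap {Λ : Finset (Site 2)}
    (hInj : Set.InjOn (Torus.proj (d := 2) L) ↑Λ) (A : FermionOp Λ) :
    ∑ i, (gcGibbsWeightTT' β t t' U μ hz L i : ℂ) *
        torusAvgExpectAt L Λ (relabel (Orb.spinSwap : Orb (PolySite Λ) ≃ Orb (PolySite Λ)) A)
          (gcGibbsVectorTT' t t' U μ hz L i) =
      ∑ i, (gcGibbsWeightTT' β t t' U μ (-hz) L i : ℂ) * torusAvgExpectAt L Λ A (gcGibbsVectorTT' t t' U μ (-hz) L i) := by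
  rw [← trace_gcGibbsDensityTT'_mul_fermionEmbed_toTorusEmb L β t t' U μ hz hInj,
    ← trace_gcGibbsDensityTT'_mul_fermionEmbed_toTorusEmb L β t t' U μ (-hz) hInj, fermionEmbed_relabel_spinSwap]
  exact trace_gcGibbsDensityTT'_mul_relabel_spinSwap L β t t' U μ hz _

/-- **The weighted translation average of the particle–hole image `α_Λ A` in the Gibbs mixture at `(t,t',U,μ,h)`
equals that of `A` at `(t,−t',U,U−μ,−h)`** (`L` even). [cite: LiebLossMccann1993, proof of Theorem] -/
theorem sum_gcGibbsWeightTT'_mul_torusAvgExpectAt_phAut (hL : Even L) {Λ : Finset (Site 2)}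
    (hInj : Set.InjOn (Torus.proj (d := 2) L) ↑Λ) (A : FermionOp Λ) :
    ∑ i, (gcGibbsWeightTT' β t t' U μ hz L i : ℂ) * torusAvgExpectAt L Λ (phAut Λ A) (gcGibbsVectorTT' t t' U μ hz L i) =
      ∑ i, (gcGibbsWeightTT' β t (-t') U (U - μ) (-hz) L i : ℂ) *
        torusAvgExpectAt L Λ A (gcGibbsVectorTT' t (-t') U (U - μ) (-hz) L i) := by
  rw [← trace_gcGibbsDensityTT'_mul_fermionEmbed_toTorusEmb L β t t' U μ hz hInj,
    ← trace_gcGibbsDensityTT'_mul_fermionEmbed_toTorusEmb L β t (-t') U (U - μ) (-hz) hInj,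
    fermionEmbed_toTorusEmb_phAut hL hInj]
  exact trace_gcGibbsDensityTT'_mul_particleHoleAut L hL β t t' U μ hz _

end Averages

end Literature.MathematicalPhysics.QuantumLattice

end
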